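import Mathlib.NumberTheory.Padics.RingHoms
import HarnessLib

/-!
# Route `AlignedTransportAtTwo`, crux C2 `MainConjectureOfRankZeroBSDAtTwo` (stmt-BirchSwinnertonDyer-22298):
# THE LOCAL LEMMA AT 2 OF THE CUBIC CHEVALLEY ROAD (ODD-BRANCH §6), anisotropic half, KERNEL:
# `c·X² + 2m·(U² − N·Z²)` has no non-trivial zero over `ℚ₂` when `c, m` are odd and `N ≡ 5 (mod 8)`;
# hence the model descent conic `⟨N(α)d⟩ ⊥ Tr_{F/ℚ₂}(α m √d · y²)` of a CLASS-D unit is insoluble at `2`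

HONEST FRAMING (cell `bsd-f1-sign2`, WIDTH-5 attached prover seat `bsd-line-att-p5` gen 32 on line `birth` of the lead `bsd-line-att-p2`;
`--supports` stmt-BirchSwinnertonDyer-22298, closes nothing; BSD is NOT proved by any of this; the crux C2, its verdict «blocked-on
`Rank1Residual.GreenbergMuConjectureIrreducible`» and every registered stub are untouched). THEOREMS ONLY (no `def`, no named fact, no `sorry`),
pure `2`-adic arithmetic; nothing about a particular curve.

CONTEXT (crux workfile `ODD-BRANCH-att-p5-g31.md` §5–§6). On the off-stratum `Δ < 0` sub-cell with `Δ_min ≡ 3, 7 (mod 8)` (`F = ℚ₂(√d)` RAMIFIED, `d ≡ 3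
(mod 4)`) g31 found numerically (275/275) and proved on paper the LOCAL DICTIONARY: the Cassels descent conic `S_η` of the unit class `ξ_η = (a, α)`,
`α = x + y√d ∈ ℤ₂[√d]^×`, `a ∼ N(α) = x² − dy²`, is — modulo squares and the unit `d` — the ternary form
`Q = N(α)·d·X² + 2md·(y·Y² + 2x·Y·Z + y·d·Z²)` (`m` odd), and `S_η(ℚ₂) = ∅ ⟺ α ∈` CLASS D `⟺ N(α) ≡ 5 (mod 8) ∧ y` odd. With Hilbert reciprocity
for conics (Cassels LMSST 24 §3) and niceness at the odd places (Yoo–Yu Thm 1.10) the direction «class D ⟹ `S_η(ℚ₂) = ∅`» is exactly what makes the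
unit-sign door VOID on that half of the odd branch. THIS FILE proves that direction in the kernel:
* §1 `padicIntTwo_ternary_eq_zero_imp` / `padicTwo_ternary_eq_zero_imp`: for `c, m` odd and `N ≡ 5 (mod 8)`, `c·X² + 2m(U² − N Z²) = 0` over `ℤ₂` / `ℚ₂`
  forces `X = U = Z = 0` — infinite descent: mod `2` `X` is even; then `U ≡ Z (mod 2)`; if both are odd, `U² − N Z² = 4·unit` (mod `16` check) and
  `c(X/2)² = −2m·unit·…` is impossible by parity of valuations; so all three are even and `(X/2, U/2, Z/2)` is a smaller zero.
  (Equivalently: the binary form `U² − N Z²` is the norm form of the UNRAMIFIED quadratic extension `ℚ₂(√5)` and takes only values of EVEN valuation,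
  while `−c X²/(2m)` has ODD valuation.)
* §2 `descentConic_classD_anisotropic`: the §6 model form `Q` above has no non-trivial zero over `ℚ₂` when `y`, `m`, `d` are odd and `x² − dy² ≡ 5 (mod 8)`
  (substitute `U = yY + xZ`: `y·Q = d·((x²−dy²)y·X² + 2m(U² − (x²−dy²)Z²))`).
The converse half (classes A, B, C are isotropic) needs Hensel lifts and is not typed here. Beyond-print theorem: no (a standard dyadic Hilbert-symbol
computation, Serre Ch. III §1.2 / Cassels *Rational Quadratic Forms* Ch. 4 Lemma 2.6); new = the kernel form keyed to the road's dictionary.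

References: [Serre1973] Ch. II §3.3, Ch. III §1.2 Thm 1; [Cassels1978RQF] Ch. 4 §2; [Cassels1991LMSST] §3, §15; [YooYu2022] Thm 1.10, Lemma 4.12;
tree pattern: `PrintCf2SplitBadTwoHPrimeBookkeeping.padicIntTwo_sq_add_mul_sq_add_sq_ne_zero` (descent via `toZModPow`).
-/

set_option linter.dupNamespace false
set_option autoImplicit false

noncomputable section

namespace Summit.BirchSwinnertonDyer.BirchSwinnertonDyer.Theorems.AlignedTransportAtTwoCubicDescentConicLocalLemma

open PadicInt

/-! ## §0 Residue arithmetic -/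

/-- In `ℤ/2`: `x² = 0 ⟹ x = 0`. [folklore] -/
private theorem zmod2_sq_eq_zero : ∀ x : ZMod 2, x ^ 2 = 0 → x = 0 := by decide

/-- In `ℤ/2`: `u² − z² = 0 ⟹ u = z`. [folklore] -/
private theorem zmod2_sq_sub_sq : ∀ u z : ZMod 2, u ^ 2 - z ^ 2 = 0 → u = z := by decide

/-- In `ℤ/16`: for `N ∈ {5, 13}` (i.e. `N ≡ 5 (mod 8)`) and odd `U = 1 + 2t`, `Z = 1 + 2s`: `U² − N Z² ∈ {4, 12}` — the norm form of
`ℚ₂(√5)` on odd pairs has valuation exactly `2`. [cite: Serre1973, Ch. II §3.3] -/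
private theorem zmod16_norm_odd : ∀ N t s : ZMod 16, (N = 5 ∨ N = 13) →
    (1 + 2 * t) ^ 2 - N * (1 + 2 * s) ^ 2 = 4 ∨ (1 + 2 * t) ^ 2 - N * (1 + 2 * s) ^ 2 = 12 := by
  decide

/-- An odd integer is `1` in `ℤ/2`. [folklore] -/
theorem intCast_zmod_two_of_odd {c : ℤ} (hc : Odd c) : (c : ZMod 2) = 1 := by
  obtain ⟨k, rfl⟩ := hc
  push_cast
  rw [show (2 : ZMod 2) = 0 from rfl]
  ring

/-- `N ≡ 5 (mod 8)` ⟹ `N = 5` or `13` in `ℤ/16`. [folklore] -/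
theorem intCast_zmod_sixteen_of_emod_eight_eq_five {N : ℤ} (hN : N % 8 = 5) : (N : ZMod 16) = 5 ∨ (N : ZMod 16) = 13 := by
  have h16 : N % 16 = 5 ∨ N % 16 = 13 := by omega
  have hn : (N : ZMod 16) = ((N % 16 : ℤ) : ZMod 16) := by simpa using (ZMod.intCast_mod N 16).symm
  rw [hn]; rcases h16 with h | h <;> rw [h] <;> decide

/-- `toZMod a = 0` in `ℤ₂` gives `a = 2a'`. [folklore] -/
theorem exists_eq_two_mul_of_toZMod_eq_zero {a : ℤ_[2]} (h : toZMod (p := 2) a = 0) : ∃ a' : ℤ_[2], a = 2 * a' := by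
  have hk : a ∈ RingHom.ker (toZMod (p := 2)) := by rw [RingHom.mem_ker, h]
  rw [ker_toZMod, maximalIdeal_eq_span_p, Ideal.mem_span_singleton] at hk
  obtain ⟨t, ht⟩ := hk
  exact ⟨t, by rw [ht]; push_cast; ring⟩

/-- `toZMod a = 1` in `ℤ₂` gives `a = 1 + 2t`. [folklore] -/
theorem exists_eq_one_add_two_mul_of_toZMod_eq_one {a : ℤ_[2]} (h : toZMod (p := 2) a = 1) : ∃ t : ℤ_[2], a = 1 + 2 * t := by
  have hk : a - 1 ∈ RingHom.ker (toZMod (p := 2)) := by rw [RingHom.mem_ker, map_sub, map_one, h, sub_self]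
  rw [ker_toZMod, maximalIdeal_eq_span_p, Ideal.mem_span_singleton] at hk
  obtain ⟨t, ht⟩ := hk
  refine ⟨t, ?_⟩
  have ht' : a = 1 + (((2 : ℕ) : ℤ_[2])) * t := by rw [← ht]; ring
  rw [ht']; push_cast; ring

/-- `toZModPow 4 a = 4` or `12` in `ℤ₂` gives `a = 4w` with `w` odd (`toZMod w = 1`). [folklore] -/
theorem exists_eq_four_mul_odd_of_toZModPow_four {a : ℤ_[2]}
    (h : toZModPow (p := 2) 4 a = 4 ∨ toZModPow (p := 2) 4 a = 12) :
    ∃ w : ℤ_[2], a = 4 * w ∧ toZMod (p := 2) w = 1 := by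
  have h4 : (4 : ZMod 2) = 0 := rfl
  have h3 : (3 : ZMod 2) = 1 := rfl
  rcases h with h | h
  · have hk : a - 4 ∈ RingHom.ker (toZModPow (p := 2) 4) := by
      rw [RingHom.mem_ker, map_sub, h, map_ofNat, sub_self]
    rw [ker_toZModPow, Ideal.mem_span_singleton] at hk
    obtain ⟨t, ht⟩ := hk
    have ht' : a = 4 + (((2 : ℕ) : ℤ_[2])) ^ 4 * t := by rw [← ht]; ring
    refine ⟨1 + 4 * t, ?_, ?_⟩
    · rw [ht']; push_cast; ring
    · rw [map_add, map_one, map_mul, map_ofNat, h4, zero_mul, add_zero]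
  · have hk : a - 12 ∈ RingHom.ker (toZModPow (p := 2) 4) := by
      rw [RingHom.mem_ker, map_sub, h, map_ofNat, sub_self]
    rw [ker_toZModPow, Ideal.mem_span_singleton] at hk
    obtain ⟨t, ht⟩ := hk
    have ht' : a = 12 + (((2 : ℕ) : ℤ_[2])) ^ 4 * t := by rw [← ht]; ring
    refine ⟨3 + 4 * t, ?_, ?_⟩
    · rw [ht']; push_cast; ring
    · rw [map_add, map_mul, map_ofNat, map_ofNat, h4, h3, zero_mul, add_zero]

/-! ## §1 The ternary form `c·X² + 2m·(U² − N·Z²)`, `c, m` odd, `N ≡ 5 (mod 8)`, is anisotropic over `ℚ₂` -/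

/-- **Descent step + induction over `ℤ₂`.** For odd integers `c, m` and `N ≡ 5 (mod 8)`: every zero `(X, U, Z) ∈ ℤ₂³` of
`c·X² + 2m·(U² − N·Z²)` is `(0,0,0)` (induction on `v(X)+v(U)+v(Z)`: mod `2` forces `2 ∣ X`, then `U ≡ Z (mod 2)`; odd `U, Z` give
`U² − N Z² = 4w`, `w` odd, and `c(X/2)² = −2mw` is impossible mod `4`; so all are even and halving gives a smaller zero).
[cite: Serre1973, Ch. II §3.3 and Ch. III §1.2 Thm 1] -/
theorem padicIntTwo_ternary_eq_zero_imp {c m N : ℤ} (hc : Odd c) (hm : Odd m) (hN : N % 8 = 5) :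
    ∀ (n : ℕ) (X U Z : ℤ_[2]), X.valuation + U.valuation + Z.valuation = n →
      (c : ℤ_[2]) * X ^ 2 + 2 * m * (U ^ 2 - N * Z ^ 2) = 0 → X = 0 ∧ U = 0 ∧ Z = 0 := by
  have hc2 : toZMod (p := 2) (c : ℤ_[2]) = 1 := by rw [map_intCast, intCast_zmod_two_of_odd hc]
  have hm2 : toZMod (p := 2) (m : ℤ_[2]) = 1 := by rw [map_intCast, intCast_zmod_two_of_odd hm]
  have hN2 : toZMod (p := 2) (N : ℤ_[2]) = 1 := by
    rw [map_intCast, intCast_zmod_two_of_odd (by rw [Int.odd_iff]; omega)]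
  have hN16 : toZModPow (p := 2) 4 (N : ℤ_[2]) = 5 ∨ toZModPow (p := 2) 4 (N : ℤ_[2]) = 13 := by
    rw [map_intCast]; exact intCast_zmod_sixteen_of_emod_eight_eq_five hN
  have h2z : toZMod (p := 2) (2 : ℤ_[2]) = 0 := by rw [map_ofNat]; rfl
  have h20 : (2 : ℤ_[2]) ≠ 0 := two_ne_zero
  intro n
  induction n using Nat.strong_induction_on with
  | _ n ih =>
  intro X U Z hn h
  -- Step 1: `X` is even
  have hX2 : toZMod (p := 2) X = 0 := by
    have h1 := congrArg (toZMod (p := 2)) h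
    simp only [map_add, map_mul, map_pow, map_sub, hc2, hm2, hN2, h2z, map_zero, one_mul, zero_mul, add_zero] at h1
    exact zmod2_sq_eq_zero _ h1
  obtain ⟨X', rfl⟩ := exists_eq_two_mul_of_toZMod_eq_zero hX2
  -- the equation divided by `2`
  have h' : 2 * (c : ℤ_[2]) * X' ^ 2 + m * (U ^ 2 - N * Z ^ 2) = 0 := by
    have : (2 : ℤ_[2]) * (2 * c * X' ^ 2 + m * (U ^ 2 - N * Z ^ 2)) = 0 := by rw [← h]; ring
    exact (mul_eq_zero.mp this).resolve_left h20
  -- Step 2: `U ≡ Z (mod 2)`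
  have hUZ : toZMod (p := 2) U = toZMod (p := 2) Z := by
    have h1 := congrArg (toZMod (p := 2)) h'
    simp only [map_add, map_mul, map_pow, map_sub, hc2, hm2, hN2, h2z, map_zero, one_mul, zero_mul, zero_add] at h1
    exact zmod2_sq_sub_sq _ _ h1
  -- Step 3: `U`, `Z` odd is impossible
  have hU0 : toZMod (p := 2) U = 0 := by
    by_contra hU1
    have hU1' : toZMod (p := 2) U = 1 := by
      rcases (by decide : ∀ r : ZMod 2, r = 0 ∨ r = 1) (toZMod (p := 2) U) with h0 | h1
      · exact absurd h0 hU1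
      · exact h1
    obtain ⟨t, ht⟩ := exists_eq_one_add_two_mul_of_toZMod_eq_one hU1'
    obtain ⟨s, hs⟩ := exists_eq_one_add_two_mul_of_toZMod_eq_one (by rw [← hUZ]; exact hU1')
    -- `U² − N Z² = 4w`, `w` odd
    have hV : toZModPow (p := 2) 4 (U ^ 2 - N * Z ^ 2) = 4 ∨ toZModPow (p := 2) 4 (U ^ 2 - N * Z ^ 2) = 12 := by
      rw [ht, hs]
      simp only [map_sub, map_mul, map_pow, map_add, map_one, map_ofNat]
      exact zmod16_norm_odd _ _ _ hN16
    obtain ⟨w, hw, hw1⟩ := exists_eq_four_mul_odd_of_toZModPow_four hV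
    rw [hw] at h'
    -- `2c X'² + 4 m w = 0` ⟹ `c X'² = −2 m w` ⟹ `X'` even ⟹ `2 c X''² = −m w` ⟹ contradiction mod 2
    have h'' : (c : ℤ_[2]) * X' ^ 2 + 2 * m * w = 0 := by
      have : (2 : ℤ_[2]) * (c * X' ^ 2 + 2 * m * w) = 0 := by rw [← h']; ring
      exact (mul_eq_zero.mp this).resolve_left h20
    have hX'2 : toZMod (p := 2) X' = 0 := by
      have h1 := congrArg (toZMod (p := 2)) h''
      simp only [map_add, map_mul, map_pow, hc2, h2z, map_zero, one_mul, zero_mul, add_zero] at h1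
      exact zmod2_sq_eq_zero _ h1
    obtain ⟨X'', rfl⟩ := exists_eq_two_mul_of_toZMod_eq_zero hX'2
    have h''' : 2 * (c : ℤ_[2]) * X'' ^ 2 + m * w = 0 := by
      have : (2 : ℤ_[2]) * (2 * c * X'' ^ 2 + m * w) = 0 := by rw [← h'']; ring
      exact (mul_eq_zero.mp this).resolve_left h20
    have h1 := congrArg (toZMod (p := 2)) h'''
    simp only [map_add, map_mul, map_pow, hm2, hw1, h2z, map_zero, zero_mul, zero_add, mul_one] at h1
    exact one_ne_zero h1
  -- Step 4: all even ⟹ descend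
  have hZ0 : toZMod (p := 2) Z = 0 := by rw [← hUZ]; exact hU0
  obtain ⟨U', rfl⟩ := exists_eq_two_mul_of_toZMod_eq_zero hU0
  obtain ⟨Z', rfl⟩ := exists_eq_two_mul_of_toZMod_eq_zero hZ0
  have hsmall : (c : ℤ_[2]) * X' ^ 2 + 2 * m * (U' ^ 2 - N * Z' ^ 2) = 0 := by
    have : (2 : ℤ_[2]) ^ 2 * (c * X' ^ 2 + 2 * m * (U' ^ 2 - N * Z' ^ 2)) = 0 := by rw [← h]; ring
    exact (mul_eq_zero.mp this).resolve_left (pow_ne_zero 2 h20)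
  -- either everything is already zero, or the valuation sum drops
  by_cases hall : X' = 0 ∧ U' = 0 ∧ Z' = 0
  · obtain ⟨rfl, rfl, rfl⟩ := hall; simp
  · exfalso
    have h2v : (2 : ℤ_[2]).valuation = 1 := by simpa using PadicInt.valuation_p (p := 2)
    have hle : ∀ a : ℤ_[2], a.valuation ≤ (2 * a).valuation := fun a ↦ by
      by_cases ha : a = 0
      · simp [ha]
      · rw [PadicInt.valuation_mul h20 ha, h2v]; omega
    have hlt1 : ∀ a : ℤ_[2], a ≠ 0 → a.valuation + 1 = (2 * a).valuation := fun a ha ↦ by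
      rw [PadicInt.valuation_mul h20 ha, h2v, add_comm]
    have hne : X' ≠ 0 ∨ U' ≠ 0 ∨ Z' ≠ 0 := by
      by_contra hcon
      push Not at hcon
      exact hall hcon
    have hlt : X'.valuation + U'.valuation + Z'.valuation < n := by
      rw [← hn]
      have hX := hle X'; have hU := hle U'; have hZ := hle Z'
      rcases hne with hX' | hU' | hZ'
      · have := hlt1 X' hX'; omega
      · have := hlt1 U' hU'; omega
      · have := hlt1 Z' hZ'; omega
    obtain ⟨hX0, hU0', hZ0'⟩ := ih _ hlt X' U' Z' rfl hsmall
    exact hall ⟨hX0, hU0', hZ0'⟩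

/-- **THE TERNARY FORM `c·X² + 2m·(U² − N·Z²)` IS ANISOTROPIC OVER `ℚ₂`** for odd integers `c, m` and `N ≡ 5 (mod 8)` (clear denominators by a
power of `2` and apply the `ℤ₂` descent). In Hilbert-symbol language: `⟨c⟩ ⊥ 2m⟨1, −N⟩` does not represent `0` because `U² − NZ²` (the norm form of
the unramified `ℚ₂(√5)`) only takes values of even valuation. [cite: Serre1973, Ch. III §1.2 Thm 1 and Ch. II §3.3] -/
theorem padicTwo_ternary_eq_zero_imp {c m N : ℤ} (hc : Odd c) (hm : Odd m) (hN : N % 8 = 5) (X U Z : ℚ_[2])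
    (h : (c : ℚ_[2]) * X ^ 2 + 2 * m * (U ^ 2 - N * Z ^ 2) = 0) : X = 0 ∧ U = 0 ∧ Z = 0 := by
  -- a common power of `2` making `X, U, Z` integral
  obtain ⟨n, hn⟩ : ∃ n : ℕ, max ‖X‖ (max ‖U‖ ‖Z‖) ≤ (2 : ℝ) ^ n := by
    obtain ⟨n, hn⟩ := pow_unbounded_of_one_lt (max ‖X‖ (max ‖U‖ ‖Z‖)) (by norm_num : (1 : ℝ) < 2)
    exact ⟨n, hn.le⟩
  have hcn : ‖((2 : ℚ_[2]) ^ n)‖ = ((2 : ℝ) ^ n)⁻¹ := by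
    have h := Padic.norm_p_pow (p := 2) n
    rw [zpow_neg, zpow_natCast] at h
    exact_mod_cast h
  have hpos : (0 : ℝ) < (2 : ℝ) ^ n := by positivity
  have hint : ∀ T : ℚ_[2], ‖T‖ ≤ max ‖X‖ (max ‖U‖ ‖Z‖) → ‖(2 : ℚ_[2]) ^ n * T‖ ≤ 1 := fun T hT ↦ by
    rw [norm_mul, hcn, inv_mul_le_iff₀ hpos, mul_one]
    exact hT.trans hn
  obtain ⟨A, hA⟩ : ∃ A : ℤ_[2], (A : ℚ_[2]) = (2 : ℚ_[2]) ^ n * X := ⟨⟨_, hint X (le_max_left _ _)⟩, rfl⟩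
  obtain ⟨B, hB⟩ : ∃ B : ℤ_[2], (B : ℚ_[2]) = (2 : ℚ_[2]) ^ n * U :=
    ⟨⟨_, hint U ((le_max_left _ _).trans (le_max_right _ _))⟩, rfl⟩
  obtain ⟨C, hC⟩ : ∃ C : ℤ_[2], (C : ℚ_[2]) = (2 : ℚ_[2]) ^ n * Z :=
    ⟨⟨_, hint Z ((le_max_right _ _).trans (le_max_right _ _))⟩, rfl⟩
  have hrel : (c : ℤ_[2]) * A ^ 2 + 2 * m * (B ^ 2 - N * C ^ 2) = 0 := by
    have h2 : ((2 : ℤ_[2]) : ℚ_[2]) = 2 := show PadicInt.Coe.ringHom (p := 2) 2 = 2 from map_ofNat _ 2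
    apply PadicInt.ext
    push_cast
    rw [hA, hB, hC, h2]
    linear_combination ((2 : ℚ_[2]) ^ n) ^ 2 * h
  obtain ⟨hA0, hB0, hC0⟩ := padicIntTwo_ternary_eq_zero_imp hc hm hN _ A B C rfl hrel
  have h2n : (2 : ℚ_[2]) ^ n ≠ 0 := pow_ne_zero n two_ne_zero
  refine ⟨?_, ?_, ?_⟩
  · have := hA.symm; rw [hA0, PadicInt.coe_zero] at this; exact (mul_eq_zero.mp this).resolve_left h2n
  · have := hB.symm; rw [hB0, PadicInt.coe_zero] at this; exact (mul_eq_zero.mp this).resolve_left h2n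
  · have := hC.symm; rw [hC0, PadicInt.coe_zero] at this; exact (mul_eq_zero.mp this).resolve_left h2n

/-- Negative form: no non-trivial zero. [cite: Serre1973, Ch. III §1.2 Thm 1] -/
theorem padicTwo_ternary_ne_zero {c m N : ℤ} (hc : Odd c) (hm : Odd m) (hN : N % 8 = 5) (X U Z : ℚ_[2])
    (hne : X ≠ 0 ∨ U ≠ 0 ∨ Z ≠ 0) : (c : ℚ_[2]) * X ^ 2 + 2 * m * (U ^ 2 - N * Z ^ 2) ≠ 0 := fun h ↦ by
  obtain ⟨hX, hU, hZ⟩ := padicTwo_ternary_eq_zero_imp hc hm hN X U Z h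
  rcases hne with h | h | h <;> exact h (by assumption)

/-! ## §2 The model descent conic of a CLASS-D unit is insoluble at `2` (ODD-BRANCH §6, direction «D ⟹ `S_η(ℚ₂) = ∅`») -/

/-- **CLASS D ⟹ THE MODEL CONIC IS ANISOTROPIC OVER `ℚ₂`.** For integers `x, y, d, m` with `y`, `m`, `d` odd and `x² − d·y² ≡ 5 (mod 8)` (so `x` is even:
the unit `α = x + y√d` of `ℤ₂[√d]` has `N(α) ≡ 5 (mod 8)` and `α ≢ 1 (mod 2)` — g31's class D), the ternary form
`Q(X, Y, Z) = (x² − dy²)·d·X² + 2md·(y·Y² + 2x·Y·Z + y·d·Z²)` (`= ⟨N(α)d⟩ ⊥ Tr_{ℚ₂(√d)/ℚ₂}(α·m·√d·(Y + Z√d)²)`) has only the trivial zero over `ℚ₂`: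
`y·Q = d·((x²−dy²)y·X² + 2m·(U² − (x²−dy²)·Z²))` with `U = yY + xZ`, and §1 applies with `c = (x² − dy²)y`, `N = x² − dy²`.
[cite: Cassels1991, §15 (pp. 66–72)] [cite: Serre1973, Ch. III §1.2 Thm 1] -/
theorem descentConic_classD_anisotropic {x y d m : ℤ} (hy : Odd y) (hm : Odd m) (hd : Odd d) (hN : (x ^ 2 - d * y ^ 2) % 8 = 5)
    (X Y Z : ℚ_[2])
    (h : ((x ^ 2 - d * y ^ 2 : ℤ) : ℚ_[2]) * d * X ^ 2 + 2 * m * d * (y * Y ^ 2 + 2 * x * Y * Z + y * d * Z ^ 2) = 0) :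
    X = 0 ∧ Y = 0 ∧ Z = 0 := by
  have hNodd : Odd (x ^ 2 - d * y ^ 2) := by rw [Int.odd_iff]; omega
  have hc : Odd ((x ^ 2 - d * y ^ 2) * y) := hNodd.mul hy
  have hd0' : d ≠ 0 := by rintro rfl; exact (by decide : ¬ Odd (0 : ℤ)) hd
  have hy0' : y ≠ 0 := by rintro rfl; exact (by decide : ¬ Odd (0 : ℤ)) hy
  have hd0 : (d : ℚ_[2]) ≠ 0 := by exact_mod_cast hd0'
  have hy0 : (y : ℚ_[2]) ≠ 0 := by exact_mod_cast hy0'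
  -- the identity `y·Q = d·(c X² + 2m(U² − N Z²))`
  have key : (((x ^ 2 - d * y ^ 2) * y : ℤ) : ℚ_[2]) * X ^ 2 +
      2 * m * ((y * Y + x * Z) ^ 2 - ((x ^ 2 - d * y ^ 2 : ℤ) : ℚ_[2]) * Z ^ 2) = 0 := by
    have : (d : ℚ_[2]) * ((((x ^ 2 - d * y ^ 2) * y : ℤ) : ℚ_[2]) * X ^ 2 +
        2 * m * ((y * Y + x * Z) ^ 2 - ((x ^ 2 - d * y ^ 2 : ℤ) : ℚ_[2]) * Z ^ 2)) = 0 := by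
      push_cast at h ⊢
      linear_combination (y : ℚ_[2]) * h
    exact (mul_eq_zero.mp this).resolve_left hd0
  obtain ⟨hX, hU, hZ⟩ := padicTwo_ternary_eq_zero_imp hc hm hN X (y * Y + x * Z) Z key
  refine ⟨hX, ?_, hZ⟩
  rw [hZ, mul_zero, add_zero] at hU
  exact (mul_eq_zero.mp hU).resolve_left hy0

end Summit.BirchSwinnertonDyer.BirchSwinnertonDyer.Theorems.AlignedTransportAtTwoCubicDescentConicLocalLemma

end
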